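import Literature.Computability.Cryptography.LiuPassLemma53Assembly
import Literature.Computability.Cryptography.GoldreichLevinTheorem
import Literature.Computability.Cryptography.GoldreichLevinProgram
import HarnessLib

/-!
# Liu–Pass Lemma 5.3 (saturated form) holds

Discharge of the named fact `liuPass_lemma53_sat` (`LiuPassLemma53Assembly.lean`): that file
proves it from the Goldreich–Levin theorem for hiding functions of fixed output length
(`liuPass_lemma53_sat_of_GL : goldreichLevin_hiding_len → liuPass_lemma53_sat`), and the
Goldreich–Levin theorem is now proved in the tree — `GLInv.goldreichLevin_hiding_len_of_eff`
(`GoldreichLevinTheorem.lean`) from the efficiency of the inverter, `GLInv.glInvRun_polyTime_holds`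
(`GoldreichLevinProgram.lean`). Nothing else is added here.

## References

* Y. Liu, R. Pass, *On one-way functions and Kolmogorov complexity*, FOCS 2020
  (arXiv:2009.11514), Lemma 5.3 (p. 14) and its proof (Appendix, §8, pp. 21–22).
* O. Goldreich, L. Levin, *A hard-core predicate for all one-way functions*, STOC 1989.
-/

namespace Literature.Computability.Cryptography

/-- **Liu–Pass 2020, Lemma 5.3 (saturated form), proved.** For an `𝒮`-one-way `f` with regularity
`r` over a saturated, dense family `𝒮` there is `c ≥ 1` such that for all `α', γ'` the hashed
family `f'_i` and the Goldreich–Levin function `GL` are polynomial-time computable, have the printed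
output lengths, `f'_{r(n)}` is `3/n^{α'/2}`-close to uniform (density) and `f'_{r(n)} ‖ GL` is
`4/n^{α'/2}`-pseudorandom — the statement `liuPass_lemma53_sat` verbatim. Obtained from
`liuPass_lemma53_sat_of_GL` and the tree's proof of the Goldreich–Levin theorem for hiding
functions (`GLInv.goldreichLevin_hiding_len_of_eff`, `GLInv.glInvRun_polyTime_holds`).
[Y. Liu, R. Pass, FOCS 2020 (arXiv:2009.11514), Lemma 5.3 and Appendix §8 (proof: LHL, Claim
"`f̂` is `𝒮`-hiding", Thm [GL89])] [cite: LiuPassFOCS2020, Lemma 5.3] -/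
theorem liuPass_lemma53_sat_holds : liuPass_lemma53_sat :=
  liuPass_lemma53_sat_of_GL (GLInv.goldreichLevin_hiding_len_of_eff GLInv.glInvRun_polyTime_holds)

end Literature.Computability.Cryptography
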